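import Literature.MathematicalPhysics.QuantumLattice.XYZGroundStateOrderHolds
import Summits.HubbardSuperconductivity.HubbardSuperconductivity.Theorems.AnisotropyChordSpinMonotoneOneMagnonRegular
import Literature.MathematicalPhysics.QuantumLattice.SpinHalfWeightSectorCounts

/-!
# Route `AnisotropyChord`: the two-magnon sector of the spin-½ XXZ model on a finite graph, I —
# pair configurations, the sector as a coordinate subspace, double counting, Ising weights
# (toolkit; bears on `Concavity` stmt-8150 and on the monotone-transport conjectures, whose first
# nontrivial sector this is)

Configurations with exactly two flipped spins (two hard-core bosons) are `e_i + e_j = Pi.single i 1 +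
Pi.single j 1` (`i ≠ j`); the sector `S^z_tot = |V|/2 − 2` is the coordinate subspace they span
(`apply_eq_zero_of_mem_twoMagnonSector`, `mem_twoMagnonSector_of_support`); sums over it are sums
over ORDERED pairs counted twice (`two_smul_sum_eq_sum_pairs`); the Ising weight of a pair
configuration is `Z(e_i+e_j) = |E|/4 − (d_i+d_j)/2 + [i∼j]` (`isingWeight_pair`, stated for `σ = e_i + e_j`
abstracted to keep elaboration cheap), from the general
vertex form `Z(σ) = |E|/4 − ½Σ_x d_x σ_x + ½Σ_{x∼y} σ_xσ_y` (`isingWeight_eq_vertex_form`).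
Part II (`…TwoMagnonCoordinates`) gives action, energy, norm and condensate in pair coordinates.
H. Tasaki (2020) §2.4, App. A.3.  No definition is introduced.
-/

set_option linter.dupNamespace false

noncomputable section

namespace Summit.HubbardSuperconductivity.HubbardSuperconductivity.Theorems.AnisotropyChord.TwoMagnon

open Matrix Complex Finset
open Literature.MathematicalPhysics.QuantumLattice
open Summit.HubbardSuperconductivity.HubbardSuperconductivity.Theorems.AnisotropyChord.OneMagnon

variable {V : Type*} [Fintype V] [DecidableEq V]

/-! ### Pair configurations -/

omit [Fintype V] in
/-- Values of the pair configuration `e_i + e_j` (`i ≠ j`): `1` on `{i, j}`, `0` elsewhere. [folklore] -/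
theorem pair_apply {i j : V} (hij : i ≠ j) (z : V) :
    (Pi.single i (1 : Fin 2) + Pi.single j 1 : V → Fin 2) z = if z = i ∨ z = j then 1 else 0 := by
  rw [Pi.add_apply]
  by_cases hzi : z = i
  · subst hzi
    rw [Pi.single_eq_same, Pi.single_eq_of_ne hij, add_zero, if_pos (Or.inl rfl)]
  · by_cases hzj : z = j
    · subst hzj
      rw [Pi.single_eq_same, Pi.single_eq_of_ne hzi, zero_add, if_pos (Or.inr rfl)]
    · rw [Pi.single_eq_of_ne hzi, Pi.single_eq_of_ne hzj, add_zero, if_neg (not_or.mpr ⟨hzi, hzj⟩)]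

omit [Fintype V] in
/-- The pair configuration as a natural-number indicator: `(e_i + e_j)_z = [z = i] + [z = j]`.
[folklore] -/
theorem pair_apply_natCast {i j : V} (hij : i ≠ j) (z : V) :
    (((Pi.single i (1 : Fin 2) + Pi.single j 1 : V → Fin 2) z : ℕ) : ℝ) =
      (if z = i then (1 : ℝ) else 0) + (if z = j then 1 else 0) := by
  rw [pair_apply hij]
  by_cases hzi : z = i
  · subst hzi; simp [hij]
  · by_cases hzj : z = j
    · subst hzj; simp [hzi]
    · simp [hzi, hzj]

/-- The pair configuration has weight `2`. [folklore] -/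
theorem weight_pair {i j : V} (hij : i ≠ j) :
    (∑ z, ((Pi.single i (1 : Fin 2) + Pi.single j 1 : V → Fin 2) z : ℕ)) = 2 := by
  have h : ∀ z, ((Pi.single i (1 : Fin 2) + Pi.single j 1 : V → Fin 2) z : ℕ) =
      (if z = i then 1 else 0) + (if z = j then 1 else 0) := fun z => by
    rw [pair_apply hij]
    by_cases hzi : z = i
    · subst hzi; simp [hij]
    · by_cases hzj : z = j
      · subst hzj; simp [hzi]
      · simp [hzi, hzj]
  simp_rw [h]
  rw [Finset.sum_add_distrib, Finset.sum_ite_eq' Finset.univ i, Finset.sum_ite_eq' Finset.univ j]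
  simp

omit [Fintype V] in
/-- `e_i + e_j = e_j + e_i`. [folklore] -/
theorem pair_comm (i j : V) :
    (Pi.single i (1 : Fin 2) + Pi.single j 1 : V → Fin 2) = Pi.single j 1 + Pi.single i 1 := add_comm _ _

omit [Fintype V] in
/-- Equality of pair configurations: `e_i + e_j = e_k + e_l` (`i ≠ j`, `k ≠ l`) iff `{i,j} = {k,l}`.
[folklore] -/
theorem pair_eq_pair_iff {i j k l : V} (hij : i ≠ j) (hkl : k ≠ l) :
    (Pi.single i (1 : Fin 2) + Pi.single j 1 : V → Fin 2) = Pi.single k 1 + Pi.single l 1 ↔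
      (i = k ∧ j = l) ∨ (i = l ∧ j = k) := by
  constructor
  · intro h
    have hk : k = i ∨ k = j := by
      have := congrFun h k
      rw [pair_apply hij, pair_apply hkl, if_pos (Or.inl rfl)] at this
      by_contra hn
      rw [if_neg hn] at this
      exact absurd this (by decide)
    have hl : l = i ∨ l = j := by
      have := congrFun h l
      rw [pair_apply hij, pair_apply hkl, if_pos (Or.inr rfl)] at this
      by_contra hn
      rw [if_neg hn] at this
      exact absurd this (by decide)
    rcases hk with rfl | rfl
    · rcases hl with rfl | rfl
      · exact absurd rfl hkl
      · exact Or.inl ⟨rfl, rfl⟩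
    · rcases hl with rfl | rfl
      · exact Or.inr ⟨rfl, rfl⟩
      · exact absurd rfl hkl
  · rintro (⟨rfl, rfl⟩ | ⟨rfl, rfl⟩)
    · rfl
    · exact pair_comm _ _

/-- A configuration of weight `2` is a pair configuration. [folklore] -/
theorem eq_pair_of_weight_eq_two {σ : V → Fin 2} (h : (∑ z, (σ z : ℕ)) = 2) :
    ∃ i j : V, i ≠ j ∧ σ = Pi.single i 1 + Pi.single j 1 := by
  have hval : ∀ z, (σ z : ℕ) ≤ 1 := fun z => by have := (σ z).isLt; omega
  -- a first occupied site
  have hex : ∃ i, σ i ≠ 0 := by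
    by_contra hno
    push Not at hno
    have h0 : (∑ z, (σ z : ℕ)) = 0 := Finset.sum_eq_zero fun z _ => by rw [hno z]; rfl
    omega
  obtain ⟨i, hi⟩ := hex
  have hi1 : (σ i : ℕ) = 1 := by
    have := hval i; have hne : (σ i : ℕ) ≠ 0 := fun h0 => hi (Fin.ext h0); omega
  -- a second occupied site
  have hrest : ∑ z ∈ Finset.univ.erase i, (σ z : ℕ) = 1 := by
    have := Finset.add_sum_erase Finset.univ (fun z => (σ z : ℕ)) (Finset.mem_univ i)
    omega
  have hex2 : ∃ j ∈ Finset.univ.erase i, σ j ≠ 0 := by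
    by_contra hno
    push Not at hno
    have h0 : ∑ z ∈ Finset.univ.erase i, (σ z : ℕ) = 0 :=
      Finset.sum_eq_zero fun z hz => by rw [hno z hz]; rfl
    omega
  obtain ⟨j, hjmem, hj⟩ := hex2
  have hji : j ≠ i := Finset.ne_of_mem_erase hjmem
  have hj1 : (σ j : ℕ) = 1 := by
    have := hval j; have hne : (σ j : ℕ) ≠ 0 := fun h0 => hj (Fin.ext h0); omega
  refine ⟨i, j, hji.symm, funext fun z => ?_⟩
  rw [pair_apply hji.symm]
  by_cases hzi : z = i
  · subst hzi; rw [if_pos (Or.inl rfl)]; exact Fin.ext hi1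
  · by_cases hzj : z = j
    · subst hzj; rw [if_pos (Or.inr rfl)]; exact Fin.ext hj1
    · rw [if_neg (not_or.mpr ⟨hzi, hzj⟩)]
      -- all other sites are empty
      have hzmem : z ∈ (Finset.univ.erase i).erase j := by simp [hzi, hzj]
      have hle : (σ j : ℕ) + (σ z : ℕ) ≤ ∑ w ∈ Finset.univ.erase i, (σ w : ℕ) := by
        rw [← Finset.add_sum_erase _ (fun w => (σ w : ℕ)) hjmem]
        exact Nat.add_le_add_left
          (Finset.single_le_sum (f := fun w => (σ w : ℕ)) (fun w _ => Nat.zero_le _) hzmem) _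
      have h0 : (σ z : ℕ) = 0 := by omega
      exact Fin.ext h0

/-! ### The two-magnon sector as a coordinate subspace -/

/-- A vector of the sector `S^z_tot = |V|/2 − 2` vanishes off the weight-`2` configurations.
Tasaki (2020) eq. (2.4.5). [folklore] -/
theorem apply_eq_zero_of_mem_twoMagnonSector {ψ : (V → Fin 2) → ℂ}
    (hψ : ψ ∈ spinZSector (Λ := V) 1 ((Fintype.card V : ℝ) / 2 - 2))
    (σ : V → Fin 2) (hσ : (∑ z, (σ z : ℕ)) ≠ 2) : ψ σ = 0 := by
  have h := LiebMattis.mem_spinZSector_weight_iff (Λ := V) 1 2 ψ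
  have hlab : (((Fintype.card V * 1 : ℕ) : ℝ) / 2 - ((2 : ℕ) : ℝ)) = (Fintype.card V : ℝ) / 2 - 2 := by
    push_cast; ring
  rw [hlab] at h
  exact (h.mp hψ) σ hσ

/-- Conversely, a vector supported on weight-`2` configurations lies in the two-magnon sector.
[folklore] -/
theorem mem_twoMagnonSector_of_support {ψ : (V → Fin 2) → ℂ}
    (hψ : ∀ σ : V → Fin 2, (∑ z, (σ z : ℕ)) ≠ 2 → ψ σ = 0) :
    ψ ∈ spinZSector (Λ := V) 1 ((Fintype.card V : ℝ) / 2 - 2) := by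
  have h := LiebMattis.mem_spinZSector_weight_iff (Λ := V) 1 2 ψ
  have hlab : (((Fintype.card V * 1 : ℕ) : ℝ) / 2 - ((2 : ℕ) : ℝ)) = (Fintype.card V : ℝ) / 2 - 2 := by
    push_cast; ring
  rw [hlab] at h
  exact h.mpr hψ

/-! ### Double counting: sums over the sector are sums over ordered pairs -/

/-- **Double counting.** A function vanishing off the weight-`2` configurations sums to half the sum
over ordered pairs: `2 • Σ_σ f(σ) = Σ_i Σ_{j ≠ i} f(e_i + e_j)`. [folklore] -/
theorem two_smul_sum_eq_sum_pairs {β : Type*} [AddCommMonoid β] (f : (V → Fin 2) → β)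
    (hf : ∀ σ, (∑ z, (σ z : ℕ)) ≠ 2 → f σ = 0) :
    2 • ∑ σ, f σ = ∑ i, ∑ j, (if i = j then 0 else f (Pi.single i 1 + Pi.single j 1)) := by
  classical
  -- the right-hand side as a sum over the off-diagonal ordered pairs
  set A : Finset (V × V) := (Finset.univ ×ˢ Finset.univ).filter (fun p => p.1 ≠ p.2) with hA
  set g : V × V → (V → Fin 2) := fun p => Pi.single p.1 1 + Pi.single p.2 1 with hg
  have hR : ∑ i, ∑ j, (if i = j then 0 else f (Pi.single i (1 : Fin 2) + Pi.single j 1)) =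
      ∑ p ∈ A, f (g p) := by
    rw [hA, Finset.sum_filter, Finset.sum_product]
    refine Finset.sum_congr rfl fun i _ => Finset.sum_congr rfl fun j _ => ?_
    by_cases h : i = j <;> simp [h, hg]
  have hcomp : ∑ p ∈ A, f (g p) = ∑ σ ∈ A.image g, (A.filter (fun p => g p = σ)).card • f σ :=
    Finset.sum_comp f g
  -- every fibre over the image has exactly two elements
  have hfib : ∀ σ ∈ A.image g, (A.filter (fun p => g p = σ)).card = 2 := by
    intro σ hσ
    obtain ⟨⟨a, b⟩, hab, rfl⟩ := Finset.mem_image.mp hσ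
    have hab' : a ≠ b := (Finset.mem_filter.mp hab).2
    have hset : A.filter (fun p => g p = g (a, b)) = {(a, b), (b, a)} := by
      ext ⟨c, d⟩
      simp only [hA, hg, Finset.mem_filter, Finset.mem_product, Finset.mem_univ, true_and,
        Finset.mem_insert, Finset.mem_singleton, Prod.mk.injEq]
      constructor
      · rintro ⟨hcd, heq⟩
        rcases (pair_eq_pair_iff hcd hab').mp heq with ⟨rfl, rfl⟩ | ⟨rfl, rfl⟩
        · exact Or.inl ⟨rfl, rfl⟩
        · exact Or.inr ⟨rfl, rfl⟩
      · rintro (⟨rfl, rfl⟩ | ⟨rfl, rfl⟩)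
        · exact ⟨hab', rfl⟩
        · exact ⟨hab'.symm, pair_comm _ _⟩
    rw [hset, Finset.card_pair]
    intro h
    rw [Prod.mk.injEq] at h
    exact hab' h.1
  -- `f` vanishes off the image, which is the set of weight-2 configurations
  have himg : ∑ σ ∈ A.image g, f σ = ∑ σ, f σ := by
    refine Finset.sum_subset (Finset.subset_univ _) fun σ _ hσ => hf σ fun hw => hσ ?_
    obtain ⟨i, j, hij, rfl⟩ := eq_pair_of_weight_eq_two hw
    exact Finset.mem_image.mpr ⟨(i, j), Finset.mem_filter.mpr ⟨Finset.mem_product.mpr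
      ⟨Finset.mem_univ _, Finset.mem_univ _⟩, hij⟩, rfl⟩
  have hR2 : ∑ σ ∈ A.image g, (A.filter (fun p => g p = σ)).card • f σ = ∑ σ ∈ A.image g, 2 • f σ :=
    Finset.sum_congr rfl (fun σ hσ => by rw [hfib σ hσ])
  rw [hR, hcomp, hR2, ← Finset.smul_sum, himg]

/-! ### Ising weights -/

variable (G : SimpleGraph V) [DecidableRel G.Adj]

/-- **The Ising weight in vertex form**: `Z(σ) = |E|/4 − ½ Σ_x d_x σ_x + ½ Σ_x Σ_y [x∼y] σ_x σ_y`
(any configuration). [folklore] -/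
theorem isingWeight_eq_vertex_form (σ : V → Fin 2) :
    (∑ e ∈ G.edgeFinset, Sym2.lift ⟨fun x y => ((1 : ℝ) / 2 - (σ x : ℕ)) * ((1 : ℝ) / 2 - (σ y : ℕ)),
        fun _ _ => mul_comm _ _⟩ e) =
      (G.edgeFinset.card : ℝ) / 4 - (1 / 2) * ∑ x, (G.degree x : ℝ) * (σ x : ℕ)
        + (1 / 2) * ∑ x, ∑ y, (if G.Adj x y then ((σ x : ℕ) : ℝ) * (σ y : ℕ) else 0) := by
  -- double the edge sum into an ordered-pair sum
  have h2 : 2 * (∑ e ∈ G.edgeFinset, Sym2.lift ⟨fun x y => ((1 : ℝ) / 2 - (σ x : ℕ)) * ((1 : ℝ) / 2 - (σ y : ℕ)),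
        fun _ _ => mul_comm _ _⟩ e) =
      ∑ x, ∑ y, (if G.Adj x y then ((1 : ℝ) / 2 - (σ x : ℕ)) * ((1 : ℝ) / 2 - (σ y : ℕ)) else 0) := by
    rw [sum_sum_ite_adj_eq_sum_edgeFinset, Finset.mul_sum]
    refine Finset.sum_congr rfl fun e _ => ?_
    induction e using Sym2.ind with
    | h x y => simp only [Sym2.lift_mk]; ring
  have hsplit : ∀ x y : V, (if G.Adj x y then ((1 : ℝ) / 2 - (σ x : ℕ)) * ((1 : ℝ) / 2 - (σ y : ℕ)) else 0) =
      (1 / 4) * (if G.Adj x y then (1 : ℝ) else 0) - (1 / 2) * (if G.Adj x y then ((σ x : ℕ) : ℝ) else 0)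
        - (1 / 2) * (if G.Adj x y then ((σ y : ℕ) : ℝ) else 0)
        + (if G.Adj x y then ((σ x : ℕ) : ℝ) * (σ y : ℕ) else 0) := fun x y => by
    split_ifs <;> ring
  have hdeg1 : ∑ x, ∑ y, (if G.Adj x y then ((σ x : ℕ) : ℝ) else 0) = ∑ x, (G.degree x : ℝ) * (σ x : ℕ) :=
    Finset.sum_congr rfl fun x _ => sum_ite_adj_const G x _
  have hdeg2 : ∑ x, ∑ y, (if G.Adj x y then ((σ y : ℕ) : ℝ) else 0) = ∑ x, (G.degree x : ℝ) * (σ x : ℕ) := by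
    rw [Finset.sum_comm]
    refine Finset.sum_congr rfl fun y _ => ?_
    rw [← sum_ite_adj_const G y]
    refine Finset.sum_congr rfl fun x _ => ?_
    simp only [G.adj_comm]
  have hE := sum_sum_boole_adj_eq_two_mul_card_edgeFinset G
  have key : ∑ x, ∑ y, (if G.Adj x y then ((1 : ℝ) / 2 - (σ x : ℕ)) * ((1 : ℝ) / 2 - (σ y : ℕ)) else 0) =
      (1 / 4) * (2 * (G.edgeFinset.card : ℝ)) - (1 / 2) * ∑ x, (G.degree x : ℝ) * (σ x : ℕ)
        - (1 / 2) * ∑ x, (G.degree x : ℝ) * (σ x : ℕ)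
        + ∑ x, ∑ y, (if G.Adj x y then ((σ x : ℕ) : ℝ) * (σ y : ℕ) else 0) := by
    simp_rw [hsplit]
    simp only [Finset.sum_add_distrib, Finset.sum_sub_distrib, ← Finset.mul_sum]
    rw [hE, hdeg1, hdeg2]
  linarith [h2, key]

/-- **Ising weight of a pair configuration**: `Z(e_i + e_j) = |E|/4 − (d_i + d_j)/2 + [i ∼ j]`.
[folklore] -/
theorem isingWeight_pair {i j : V} (hij : i ≠ j) (σ : V → Fin 2)
    (hσ : σ = Pi.single i 1 + Pi.single j 1) :
    (∑ e ∈ G.edgeFinset, Sym2.lift ⟨fun x y => ((1 : ℝ) / 2 - (σ x : ℕ)) * ((1 : ℝ) / 2 - (σ y : ℕ)),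
        fun _ _ => mul_comm _ _⟩ e) =
      (G.edgeFinset.card : ℝ) / 4 - ((G.degree i : ℝ) + (G.degree j : ℝ)) / 2
        + (if G.Adj i j then 1 else 0) := by
  rw [isingWeight_eq_vertex_form]
  subst hσ
  simp_rw [pair_apply_natCast hij]
  have h1 : ∑ x, (G.degree x : ℝ) * ((if x = i then (1 : ℝ) else 0) + (if x = j then 1 else 0)) =
      (G.degree i : ℝ) + (G.degree j : ℝ) := by
    simp only [mul_add, Finset.sum_add_distrib, mul_ite, mul_one, mul_zero, Finset.sum_ite_eq', Finset.mem_univ,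
      if_true]
  have hab : ∀ a b : V, ∑ x, ∑ y, (if G.Adj x y then (if x = a then (1 : ℝ) else 0) * (if y = b then 1 else 0) else 0)
      = if G.Adj a b then 1 else 0 := by
    intro a b
    rw [Finset.sum_eq_single a, Finset.sum_eq_single b]
    · simp
    · intro y _ hyb; simp [hyb]
    · intro h; exact absurd (Finset.mem_univ b) h
    · intro x _ hxa; exact Finset.sum_eq_zero (fun y _ => by simp [hxa])
    · intro h; exact absurd (Finset.mem_univ a) h
  have h2 : ∑ x, ∑ y, (if G.Adj x y then
      ((if x = i then (1 : ℝ) else 0) + (if x = j then 1 else 0)) * ((if y = i then (1 : ℝ) else 0) + (if y = j then 1 else 0))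
      else 0) = 2 * (if G.Adj i j then 1 else 0) := by
    have hterm : ∀ x y : V, (if G.Adj x y then
        ((if x = i then (1 : ℝ) else 0) + (if x = j then 1 else 0)) * ((if y = i then (1 : ℝ) else 0) + (if y = j then 1 else 0))
        else 0) =
        (if G.Adj x y then (if x = i then (1 : ℝ) else 0) * (if y = i then 1 else 0) else 0)
        + (if G.Adj x y then (if x = i then (1 : ℝ) else 0) * (if y = j then 1 else 0) else 0)
        + (if G.Adj x y then (if x = j then (1 : ℝ) else 0) * (if y = i then 1 else 0) else 0)
        + (if G.Adj x y then (if x = j then (1 : ℝ) else 0) * (if y = j then 1 else 0) else 0) := by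
      intro x y; split_ifs <;> ring
    simp_rw [hterm]
    simp only [Finset.sum_add_distrib]
    rw [hab, hab, hab, hab, if_neg (G.irrefl (v := i)), if_neg (G.irrefl (v := j))]
    simp only [G.adj_comm j i]
    ring
  rw [h1, h2]
  ring

end Summit.HubbardSuperconductivity.HubbardSuperconductivity.Theorems.AnisotropyChord.TwoMagnon
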